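import Summits.ABC.IUTFork.Joshi.ArithmeticoidProperties
import Summits.ABC.IUTFork.Joshi.ArithmeticoidPeriods
import Mathlib.FieldTheory.RatFunc.Degree
import Mathlib.FieldTheory.RatFunc.AsPolynomial
import Mathlib.Topology.MetricSpace.Basic

/-!
# A one-place TOY MODEL of the signature `ATS2h.DeformationDatum` ([J-2½] arXiv:2305.10398 §4–§5) — joint
# satisfiability of its fields, and the toy's verdicts on the claim-`Prop`s (no mathematical content about number fields)

Block E support file (cell abc-iut, rung LADDER-ABC:A2.E, seat abc-iut-E-t37). The object files `Joshi/Arithmeticoids.lean` (p430482),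
`Joshi/ArithmeticoidProperties.lean` (p430871), `Joshi/ArithmeticoidPeriods.lean` (p430897) type Joshi's [J-2½] §4–§5 over the HYPOTHESIS
structure `DeformationDatum L V Lv Y K G A` (28 fields, among them the product formula (5.3.1)/(5.3.2), the normalization law (5.3.3),
Bourbaki valued fields §2.3). Every claim-`Prop` there quantifies over such a datum; if the fields were jointly UNSATISFIABLE, all of
them would be vacuous (CONVENTIONS §4 «∃ over an empty type»). This file certifies they are not, by an honest DEGENERATE model:

* `L = ℚ`, ONE non-archimedean place (`V = Unit`, `V^arc = ∅`, `p_v = 2`), `L_v = K_y = ℚ(X)` (Mathlib `RatFunc ℚ`, `L ↪ L_v` = `RatFunc.C`) with the DEGREE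
  absolute value `|r| = 2^{deg r}` (`degAbs`; ultrametric, so a Bourbaki valued field with `A = 1`; non-trivial: `|X| = 2`; TRIVIAL on the
  constants `ℚ*`, which is exactly what makes the one-place product formula `Σ_v log|x|_v = 0` hold), one point `|Y| = Unit`, all groups
  and actions trivial, `ϕ_v = 1`, `α = 1`, the uninterpreted predicates `False`, `valueGroupCompletion = ∅`.
* `toyDatum` : the model; `toy_nonempty` : the signature is inhabited.
* The toy's verdicts on the claim-`Prop`s of the object files (documentation that they are CONTENTFUL, i.e. neither tautologies nor
  contradictions of the signature): `LActsByFrobeniusPowers` HOLDS in the toy (`toy_lActsByFrobeniusPowers`); `Thm552_7` («topologically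
  inequivalent arithmeticoids exist») FAILS in the toy (`not_toy_thm552_7`: one point) — so it is not a consequence of the signature;
  `PeriodMapNonconstant` FAILS in the toy (`not_toy_periodMapNonconstant`) — likewise contentful; `Prop472` / `Prop483` hold vacuously
  (`base = cp`).

Nothing here is a statement about Joshi's mathematics or about [IUTchIII]; typed ≠ proved; no side taken. [claim: Joshi2023ATS2half,
status: disputed] applies to the quoted claim-`Prop`s only; the model itself is [folklore].
-/

noncomputable section

open TopologicalSpace

namespace Summit.ABC.IUTFork.Joshi.ATS2h

namespace Toy

open RatFunc

/-- The degree absolute value on `ℚ(X)`: `|0| = 0`, `|r| = 2^{intDegree r}` otherwise (the place at infinity of `ℚ(X)`, written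
multiplicatively with base `2`). [folklore] -/
def degAbs (r : RatFunc ℚ) : ℝ := by
  classical
  exact if r = 0 then 0 else (2 : ℝ) ^ r.intDegree

/-- `|0| = 0`. [folklore] -/
@[simp] theorem degAbs_zero : degAbs 0 = 0 := by simp [degAbs]

/-- `|r| = 2^{deg r}` for `r ≠ 0`. [folklore] -/
theorem degAbs_of_ne_zero {r : RatFunc ℚ} (hr : r ≠ 0) : degAbs r = (2 : ℝ) ^ r.intDegree := by simp [degAbs, hr]

/-- `|r| > 0` for `r ≠ 0`. [folklore] -/
theorem degAbs_pos {r : RatFunc ℚ} (hr : r ≠ 0) : 0 < degAbs r := by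
  rw [degAbs_of_ne_zero hr]; positivity

/-- The constants have absolute value `1`. [folklore] -/
theorem degAbs_C {c : ℚ} (hc : c ≠ 0) : degAbs (RatFunc.C c) = 1 := by
  have : RatFunc.C c ≠ 0 := by simpa using hc
  rw [degAbs_of_ne_zero this, RatFunc.intDegree_C, zpow_zero]

/-- `|X| = 2`. [folklore] -/
theorem degAbs_X : degAbs (RatFunc.X : RatFunc ℚ) = 2 := by
  rw [degAbs_of_ne_zero RatFunc.X_ne_zero, RatFunc.intDegree_X, zpow_one]

/-- The degree absolute value is a Bourbaki valued field structure on `ℚ(X)` (ultrametric: constant `A = 1`; non-trivial: `|X| = 2`).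
[folklore] -/
theorem degAbs_isValuedField : IsValuedField degAbs where
  nonneg r := by
    by_cases hr : r = 0
    · simp [hr]
    · exact (degAbs_pos hr).le
  eq_zero_iff r := by
    refine ⟨fun h => ?_, fun h => by simp [h]⟩
    by_contra hr
    exact (degAbs_pos hr).ne' h
  map_mul x y := by
    by_cases hx : x = 0
    · simp [hx]
    by_cases hy : y = 0
    · simp [hy]
    rw [degAbs_of_ne_zero (mul_ne_zero hx hy), degAbs_of_ne_zero hx, degAbs_of_ne_zero hy,
      RatFunc.intDegree_mul hx hy, zpow_add₀ (by norm_num : (2 : ℝ) ≠ 0)]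
  exists_const := by
    refine ⟨1, one_pos, fun x y => ?_⟩
    rw [one_mul]
    by_cases hxy : x + y = 0
    · rw [hxy, degAbs_zero]
      exact le_max_of_le_left (by by_cases hx : x = 0 <;> [simp [hx]; exact (degAbs_pos hx).le])
    by_cases hy : y = 0
    · simp [hy]
    by_cases hx : x = 0
    · simp [hx]
    rw [degAbs_of_ne_zero hxy, degAbs_of_ne_zero hx, degAbs_of_ne_zero hy]
    rcases le_max_iff.1 (RatFunc.intDegree_add_le hy hxy) with h | h
    · exact le_max_of_le_left (zpow_le_zpow_right₀ (by norm_num) h)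
    · exact le_max_of_le_right (zpow_le_zpow_right₀ (by norm_num) h)
  nontrivial := ⟨RatFunc.X, RatFunc.X_ne_zero, by rw [degAbs_X]; norm_num⟩

/-- The degree absolute value is ULTRAMETRIC: `|x + y| ≤ max(|x|, |y|)` (the constant `A = 1` of `degAbs_isValuedField`, isolated for
consumers that take non-archimedeanness as a hypothesis — e.g. seat T-38's `IsNonarchimedeanAbs`). [folklore] -/
theorem degAbs_add_le_max (x y : RatFunc ℚ) : degAbs (x + y) ≤ max (degAbs x) (degAbs y) := by
  by_cases hxy : x + y = 0
  · rw [hxy, degAbs_zero]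
    exact le_max_of_le_left (by by_cases hx : x = 0 <;> [simp [hx]; exact (degAbs_pos hx).le])
  by_cases hy : y = 0
  · simp [hy]
  by_cases hx : x = 0
  · simp [hx]
  rw [degAbs_of_ne_zero hxy, degAbs_of_ne_zero hx, degAbs_of_ne_zero hy]
  rcases le_max_iff.1 (RatFunc.intDegree_add_le hy hxy) with h' | h'
  · exact le_max_of_le_left (zpow_le_zpow_right₀ (by norm_num) h')
  · exact le_max_of_le_right (zpow_le_zpow_right₀ (by norm_num) h')

/-- Hence the ordinary TRIANGLE inequality `|x + y| ≤ |x| + |y|` (the hypothesis `TriangleValued` of seat T-05's merge map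
`ATS3.ArithFFDatum.ofDeformation` holds at the toy). [folklore] -/
theorem degAbs_add_le (x y : RatFunc ℚ) : degAbs (x + y) ≤ degAbs x + degAbs y :=
  (degAbs_add_le_max x y).trans (max_le_add_of_nonneg (degAbs_isValuedField.nonneg x) (degAbs_isValuedField.nonneg y))

end Toy

open Toy in
/-- **The toy model** of `DeformationDatum`: `L = ℚ`, one non-archimedean place, `L_v = K = ℚ(X)` with the degree absolute value,
one point, trivial groups / actions / Frobenius, `α = 1`. DEGENERATE by design — it certifies joint satisfiability of the 28 fields
and nothing else. [folklore] -/
def toyDatum : DeformationDatum ℚ Unit (fun _ => RatFunc ℚ) (fun _ => Unit) (fun _ _ => RatFunc ℚ) (fun _ => Unit)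
    (fun _ => Unit) where
  base := TiltBase.cp
  Varc := ∅
  countable_V := inferInstance
  p := fun _ => 2
  p_prime := fun _ _ => Nat.prime_two
  p_arch := fun _ h => (Set.notMem_empty _ h).elim
  toLv := fun _ => RatFunc.C
  metrizable := fun _ => inferInstance
  pt0 := fun _ => ()
  frob := fun _ => Homeomorph.refl Unit
  frob_arch := fun _ _ => rfl
  gal := fun _ => 1
  ord := fun _ => 1
  ord_arch := fun _ _ => rfl
  act := fun _ => 1
  lt := fun _ => 1
  absK := fun _ _ => degAbs
  absK_isValuedField := fun _ _ => degAbs_isValuedField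
  emb := fun _ _ => RingHom.id _
  absLv := fun _ => degAbs
  absLv_isValuedField := fun _ => degAbs_isValuedField
  finite_absLv_ne_one := fun _ => Set.toFinite _
  sum_log_absLv := fun x => by
    show ∑ᶠ _ : Unit, Real.log (degAbs (RatFunc.C (x : ℚ))) = 0
    rw [degAbs_C x.ne_zero, Real.log_one]
    exact finsum_zero
  α := fun _ _ => 1
  α_pos := fun _ _ => one_pos
  absLv_eq_rpow := fun _ _ x => by simp
  IsMaxComplete := fun _ _ => False
  ResidueFieldOfCompletion := fun _ _ => False
  ResidueFieldFpBar := fun _ _ => False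
  valueGroupCompletion := fun _ => ∅

/-- The signature `DeformationDatum` is inhabited (over the toy carriers): its fields are jointly satisfiable. [folklore] -/
theorem toy_nonempty : Nonempty (DeformationDatum ℚ Unit (fun _ => RatFunc ℚ) (fun _ => Unit) (fun _ _ => RatFunc ℚ)
    (fun _ => Unit) (fun _ => Unit)) := ⟨toyDatum⟩

/-! ## The toy's verdicts on the claim-`Prop`s (contentfulness documentation) -/

/-- [J-2½] Thm. 4.2.3 (4) as typed (`LActsByFrobeniusPowers`) HOLDS in the toy (all actions trivial). [folklore] -/
theorem toy_lActsByFrobeniusPowers : toyDatum.LActsByFrobeniusPowers := by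
  intro v _ x
  simp [toyDatum]

/-- In the toy there is exactly one arithmeticoid. [folklore] -/
theorem toy_arith_subsingleton (y₁ y₂ : toyDatum.Arith) : y₁ = y₂ := funext fun _ => rfl

/-- [J-2½] Thm. 5.5.2 (7) as typed (`Thm552_7`, «topologically inequivalent arithmeticoids exist») FAILS in the toy (one point, and
topological equivalence is reflexive) — so it is NOT a consequence of the signature: a contentful claim. [folklore] -/
theorem not_toy_thm552_7 : ¬ toyDatum.Thm552_7 := by
  rintro ⟨y₁, y₂, h⟩
  rw [toy_arith_subsingleton y₁ y₂] at h
  exact h (DeformationDatum.TopEquivalent.refl _ y₂)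

/-- [J-2½] Thm. 5.10.1 (7)'s non-constancy (`PeriodMapNonconstant`) FAILS in the toy (one point) — contentful, not a consequence of
the signature. [folklore] -/
theorem not_toy_periodMapNonconstant : ¬ toyDatum.PeriodMapNonconstant := by
  rintro ⟨y₁, y₂, h⟩
  rw [toy_arith_subsingleton y₁ y₂] at h
  exact h rfl

/-- Every residue-field valuation of the toy is ultrametric, hence satisfies the ordinary triangle inequality — the shape of the
hypothesis `TriangleValued` of seat T-05's `ATS3.ArithFFDatum.ofDeformation` (so the [J-III] §2 signature is inhabited over the toy as
well, once that file is imported). [folklore] -/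
theorem toy_absK_add_le (v : Unit) (y : Unit) (a b : RatFunc ℚ) :
    toyDatum.absK v y (a + b) ≤ toyDatum.absK v y a + toyDatum.absK v y b := Toy.degAbs_add_le a b

/-- [J-2½] Prop. 4.7.2 as typed holds VACUOUSLY in the toy (`base = cp ≠ maxComplete`). [folklore] -/
theorem toy_prop472 : toyDatum.Prop472 := fun h => by simp [DeformationDatum.IsDef471, toyDatum] at h

/-- [J-2½] Prop. 4.8.3 as typed holds VACUOUSLY in the toy (`base = cp ≠ realified`). [folklore] -/
theorem toy_prop483 : toyDatum.Prop483 := fun h => by simp [DeformationDatum.IsDef481, toyDatum] at h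

end Summit.ABC.IUTFork.Joshi.ATS2h
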